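import Summits.QuantumFields.BalabanUV.T4Continuum.Support.ShellMeasureWilsonLedgerSUN
import Summits.QuantumFields.BalabanUV.T4Continuum.Support.ShellMeasureWilsonLedgerSource

/-!
# `T4Continuum.ShellMeasureWilsonLedgerSUNSource` — row S19 file 2 at `G := SU(N)`: END-I's level-0 ledger wants a
# ledger AT EVERY SOURCE STRENGTH `|t| ≤ l₀`; the realized measures there are the GENERATING-FUNCTION (source-inserted)
# `SU(N)` Gibbs laws — a bounded multiplicative tilt `e^{t·F}` costs only a constant factor in (M1)₀
# (+ §3: row S19 file 3's cutoff-indexed lattice FAMILY) (cell `pub-balaban`, sub-cell `t4`, spine estimate NE7c (node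
# U5b); NE7c ROUND-2 crew `t4-ne7c-formalise-*`, unit `b2b-balaban-t4-ne7c-formalise-leaf-06` gen 3, row S45 «S19 FOR
# SU(N)» file 3; c5-OPTIONAL SU(N) orbit — SU(2) is the row's certified instance; ADDITIVE — imports this row's
# `ShellMeasureWilsonLedgerSUN` (file 2) and row S19's `ShellMeasureWilsonLedgerSource` (p209573, for its ABSTRACT §1 tilt
# lemmas BY NAME) only; 0 `def`, 0 sorry, 0 cite tags)

HONEST FRAMING.  Finite four-torus programme, rung (B)+1 only — NOT infinite volume, NOT a mass gap, NOT the Clay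
problem, NOT summit progress.  NE7c = `T4IndicatorShell.ShellWeightBound` is NOT PRINTED in [Balaban 1983–89] and NOT
PROVED; «NE7c ⇐ the named binders» (trigger c3); a ONE-run level-0 ledger is NOT NE7c; (M1)₀ realized ≠ NE7c; SU(2)
the certified instance (c5).  WHAT THIS FILE DOES: row S19 f2 (`ShellMeasureWilsonLedgerSource`) §2–§3 at
`G := SU(N)`, token for token: the abstract tilt lemma `ShellMeasureWilsonLedgerSource.slotAntiConcentration_withDensity_mul_exp`
((M1) survives a density factor with values in `[a, b]`, `0 < a`, at the price `D ↦ D·b/a`; for `e^{t·f}`, `|f| ≤ w`,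
`|t| ≤ l₀` the price is `e^{2 l₀ w}`) applied to file 2's `slotAntiConcentration_wilson_suN_gibbs_of_union`, then row
S17's `levelLedger_levelZero_cubes` with the `t`-dependent tilted laws.  Nothing printed is asserted; [folklore]
composition of tree lemmas BY NAME.  HONEST DEPENDENCY (cell): continuum YM on T⁴ ⇐ BetaPertH ∧ nine spine estimates
(0/9 proved); BetaPertH ⇐ (D1) ∧ (D4) ∧ CAP+tail; G-an2-4 gates asym, D1 and NE2/3/4.

## What is proved (all [folklore])

* §1 `slotAntiConcentration_wilson_suN_gibbs_source` — file 2's `…_gibbs_of_union` for the tilted `SU(N)` law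
  `e^{t·Fobs} e^{−β Σ_{P_all}} dU`, `|Fobs| ≤ w`, `|t| ≤ l₀`: (M1)₀ with constant row S34's `× e^{2 l₀ w}`.
* §2 `levelLedger_wilson_suN_levelZero_source` — file 2's ledger with the realized measures `μ K t` = the tilted laws
  (genuinely `t`-dependent, as END-I's `SlotData.μ : ∀ K, ℝ → …` allows); displayed binders as before (closeness under
  `μ K t`, numerics, `D_s·e^{2 l₀ w} ≤ D 0`).
* §3 `levelLedger_wilson_suN_levelZero_family` — row S19 f3 (`ShellMeasureWilsonLedgerFamily`, its v1.1 form) at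
  `G := SU(N)`: the ledger over a CUTOFF-INDEXED FAMILY of lattices `P K` (levels `jl K`) with per-`K` couplings `β K`,
  windows `S K`, co-test thresholds `σc K`, radii `Rad K` and sources `Fobs K` — END-I's literal `Ω : ℕ → σ → Type*`
  generality — with the UNIFORMITY-IN-THE-CUTOFF of the level-0 constant DISPLAYED as one binder on the LIVE slots
  (`hD : ∀ K, ∀ s ∈ C K, D_{K,s}·e^{2 l₀ w} ≤ D 0`, SM-L10 at level 0; it couples `S K` to `β K` — for the instantiator).

WHAT THIS DOES NOT DO.  Unbounded sources; no verification that print's coupling-scaled windows meet `hD`; anything at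
`j ≥ 1`; NE7c NOT proved; 0/9 spine.
-/

noncomputable section

open Set Function MeasureTheory Finset

namespace Summit.QuantumFields.BalabanUV.T4Continuum.ShellMeasureWilsonLedgerSUNSource

open scoped ENNReal
open Literature.MathematicalPhysics.QuantumFieldTheory.Balaban1983to89
open T4ShellMeasure (SlotAntiConcentration)
open T4ShellMeasureLevels (LevelLedger)
open ShellMeasureExpChartSUN (SUN dimSU)
open T4AxialGaugeFixing (combBonds)
open T4AxialGaugeSmallField (boxPlaqs boxBonds)
open ShellMeasureWilsonRealizedSUN (wilsonU measurable_wilsonU measurable_wilsonSum wilsonSum_nonneg)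
open ShellMeasureRootCompositionPushCubes (regionWeight regionShell regionPiece levelLedger_levelZero_cubes)
open ShellMeasureWilsonLedgerSource (slotAntiConcentration_withDensity_mul_exp)
open ShellMeasureWilsonLedgerSUN (slotAntiConcentration_wilson_suN_gibbs_of_union)

variable {N : ℕ} [NeZero N] {P : Params} {j : ℕ} [DecidableEq (PBond P j)] [DecidableEq (Plaq P j)]

/-! ## §1 (M1)₀ for the tilted `SU(N)` Gibbs law `e^{t·F} e^{−β S_W} dU` -/

/-- **(M1)₀ FOR THE SOURCE-TILTED LEVEL-0 `SU(N)` GIBBS LAW.**  File 2's `slotAntiConcentration_wilson_suN_gibbs_of_union`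
(leaf-10's geometry/numerics and `SU(N)` reach, classifier covering its box, `θ ≤ σ`, `P_ext` avoiding the chart
block, `P_ext ∪ P_w = P_all`) tilted by a bounded observable `Fobs` (`|Fobs| ≤ w`) at source strength `|t| ≤ l₀`:
`SlotAntiConcentration ((fieldMeasure P j SU(N)).withDensity (e^{t·Fobs U} · e^{−β Σ_{P_all}(1 − reTr U(∂p))}))
(wilsonU P_u) θ ρ (2(#Λ·d_N + β·#P_w·4S(8+16S))/(1−δ) · e^{2 l₀ w})`. [folklore] -/
theorem slotAntiConcentration_wilson_suN_gibbs_source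
    {lo hi : Fin P.d → ℤ} {m : ℕ} (hN : ∀ κ, hi κ - lo κ < P.sitesPerDir j) (hm : ∀ κ, hi κ ≤ lo κ + m)
    (Λ : Finset (PBond P j)) (hΛbox : ∀ b ∈ Λ, b ∈ boxBonds lo hi)
    (hΛcomb : Disjoint Λ (combBonds lo hi))
    (hcov : ∀ b ∈ boxBonds lo hi, b ∉ Λ → b ∈ (combBonds lo hi : Finset (PBond P j)))
    {S σ : ℝ} (hS : 0 ≤ S) (hS4 : S ≤ 1 / 4) (hσ : 0 < σ)
    (hN4 : (N : ℝ) * (((P.d - 1 : ℕ) : ℝ) * m * σ) < 4)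
    (hrad : Real.sqrt N * (Real.pi / 2 * (((P.d - 1 : ℕ) : ℝ) * m * σ)) ≤ S)
    {Pu : Finset (Plaq P j)} (hPu : Pu.Nonempty) (hPubox : ∀ p ∈ Pu, p ∈ boxPlaqs lo hi)
    (hboxPu : boxPlaqs lo hi ⊆ (↑Pu : Set (Plaq P j)))
    (Pw Pext Pall : Finset (Plaq P j)) {β θ δ ρ Rad : ℝ} (hβ : 0 ≤ β) (hθ : 0 < θ) (hθσ : θ ≤ σ) (hδ0 : 0 ≤ δ)
    (hδ1 : δ < 1) (hρ0 : 0 ≤ ρ) (hρ : ρ ≤ (1 - δ) / 2) (hRad : 1 < Rad)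
    (hSM : 36 * (Real.exp (4 * S * Rad) - 1) / (Rad - 1) ^ 2 ≤ δ * θ)
    (hSMσ : 4 * (4 * S) ^ 2 * Real.exp (2 * (4 * S)) ≤ δ * σ)
    (hPext : ∀ p ∈ Pext, (⟨p.src, p.μ⟩ : PBond P j) ∉ Λ ∧ (⟨p.src.shift p.μ, p.ν⟩ : PBond P j) ∉ Λ ∧
      (⟨p.src.shift p.ν, p.μ⟩ : PBond P j) ∉ Λ ∧ (⟨p.src, p.ν⟩ : PBond P j) ∉ Λ)
    (hdisj : Disjoint Pext Pw) (hall : Pext ∪ Pw = Pall)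
    {Fobs : GaugeField P j (SUN N) → ℝ} {w l₀ t : ℝ} (hw : 0 ≤ w) (hFw : ∀ U, |Fobs U| ≤ w) (ht : |t| ≤ l₀) :
    SlotAntiConcentration
      ((fieldMeasure P j (SUN N)).withDensity fun U => ENNReal.ofReal (Real.exp (t * Fobs U)) *
        ENNReal.ofReal (Real.exp (-(β * ∑ p ∈ Pall, (1 - reTr (GaugeField.plaqHol U p))))))
      (wilsonU hPu) θ ρ
      (2 * (((Λ.card * dimSU N : ℕ) : ℝ) + β * ∑ _p ∈ Pw, (4 * S) * (8 + 4 * (4 * S))) / (1 - δ) *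
        Real.exp (2 * l₀ * w)) := by
  have h1δ : 0 < 1 - δ := by linarith
  refine slotAntiConcentration_withDensity_mul_exp (fieldMeasure P j (SUN N)) ?_ hw hFw ht ?_ hρ0
    (slotAntiConcentration_wilson_suN_gibbs_of_union hN hm Λ hΛbox hΛcomb hcov hS hS4 hσ hN4 hrad hPu hPubox hboxPu
      Pw Pext Pall hβ hθ hθσ hδ0 hδ1 hρ0 hρ hRad hSM hSMσ hPext hdisj hall)
  · exact ENNReal.measurable_ofReal.comp
      (Real.measurable_exp.comp (measurable_const.mul (measurable_wilsonSum Pall)).neg)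
  · exact div_nonneg (mul_nonneg zero_le_two (add_nonneg (Nat.cast_nonneg _)
      (mul_nonneg hβ (Finset.sum_nonneg fun _ _ => by positivity)))) h1δ.le

/-! ## §2 The level-0 ledger of the tilted `SU(N)` Gibbs measures `μ K t = e^{t·F} e^{−β S_W} dU` -/

section Ledger

variable {σ₀ : Type*} [DecidableEq σ₀]

/-- **THE LEVEL-0 ONE-RUN LEDGER OF THE SOURCE-TILTED `SU(N)` GIBBS MEASURES ⇐ CLOSENESS + NUMERICS ONLY.**  File 2's
`levelLedger_wilson_suN_levelZero` with the realized measure of every slot at source strength `t` THE TILTED law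
`μ t = e^{t·Fobs} e^{−β Σ_{P_all}} dU` (a bounded observable, `|Fobs| ≤ w`), (M1)₀ discharged per slot for `|t| ≤ l₀`
by §1 and raised to the uniform `D 0` (`D_s · e^{2 l₀ w} ≤ D 0`).  DISPLAYED: the other run's measurable tested
variables `u^B`, the per-cube a.e. closeness `|wilsonU_s − u^B_s| ≤ ρ₀θ₀` under `μ t`, the numerics.  NOT NE7c;
SU(2) the certified instance; nothing printed asserted. [folklore] -/
theorem levelLedger_wilson_suN_levelZero_source
    (lo hi : σ₀ → Fin P.d → ℤ) (m : σ₀ → ℕ) (hN : ∀ s κ, hi s κ - lo s κ < P.sitesPerDir j)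
    (hm : ∀ s κ, hi s κ ≤ lo s κ + m s)
    (Λ : σ₀ → Finset (PBond P j)) (hΛbox : ∀ s, ∀ b ∈ Λ s, b ∈ boxBonds (lo s) (hi s))
    (hΛcomb : ∀ s, Disjoint (Λ s) (combBonds (lo s) (hi s)))
    (hcov : ∀ s, ∀ b ∈ boxBonds (lo s) (hi s), b ∉ Λ s → b ∈ (combBonds (lo s) (hi s) : Finset (PBond P j)))
    {S σ : ℝ} (hS : 0 ≤ S) (hS4 : S ≤ 1 / 4) (hσ : 0 < σ)
    (hN4 : ∀ s, (N : ℝ) * (((P.d - 1 : ℕ) : ℝ) * m s * σ) < 4)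
    (hrad : ∀ s, Real.sqrt N * (Real.pi / 2 * (((P.d - 1 : ℕ) : ℝ) * m s * σ)) ≤ S)
    (Pu : σ₀ → Finset (Plaq P j)) (hPu : ∀ s, (Pu s).Nonempty) (hPubox : ∀ s, ∀ p ∈ Pu s, p ∈ boxPlaqs (lo s) (hi s))
    (hboxPu : ∀ s, boxPlaqs (lo s) (hi s) ⊆ (↑(Pu s) : Set (Plaq P j)))
    (Pw Pext : σ₀ → Finset (Plaq P j)) (Pall : Finset (Plaq P j)) {β δ Rad : ℝ} {θ ρ D : ℕ → ℝ} (hβ : 0 ≤ β)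
    (hθ : 0 < θ 0) (hθσ : θ 0 ≤ σ) (hδ0 : 0 ≤ δ) (hδ1 : δ < 1) (hρ0 : ∀ i, 0 ≤ ρ i) (hρ : ρ 0 ≤ (1 - δ) / 2)
    (hRad : 1 < Rad) (hSM : 36 * (Real.exp (4 * S * Rad) - 1) / (Rad - 1) ^ 2 ≤ δ * θ 0)
    (hSMσ : 4 * (4 * S) ^ 2 * Real.exp (2 * (4 * S)) ≤ δ * σ)
    (hPext : ∀ s, ∀ p ∈ Pext s, (⟨p.src, p.μ⟩ : PBond P j) ∉ Λ s ∧ (⟨p.src.shift p.μ, p.ν⟩ : PBond P j) ∉ Λ s ∧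
      (⟨p.src.shift p.ν, p.μ⟩ : PBond P j) ∉ Λ s ∧ (⟨p.src, p.ν⟩ : PBond P j) ∉ Λ s)
    (hdisj : ∀ s, Disjoint (Pext s) (Pw s)) (hall : ∀ s, Pext s ∪ Pw s = Pall)
    -- the source: a bounded observable tilting the Gibbs law, strength `|t| ≤ l₀`
    {Fobs : GaugeField P j (SUN N) → ℝ} {w l₀ : ℝ} (hw : 0 ≤ w) (hFw : ∀ U, |Fobs U| ≤ w)
    (hD0 : ∀ i, 0 ≤ D i)
    (hD : ∀ s, 2 * ((((Λ s).card * dimSU N : ℕ) : ℝ) + β * ∑ _p ∈ Pw s, (4 * S) * (8 + 4 * (4 * S))) / (1 - δ) *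
      Real.exp (2 * l₀ * w) ≤ D 0)
    -- the run's cubes per cutoff, the other run's tested variables, the closeness (node U1b at level 0)
    (C : ℕ → Finset σ₀) (uB : ℕ → ℝ → σ₀ → GaugeField P j (SUN N) → ℝ) (huB : ∀ K t s, Measurable (uB K t s))
    (hclose : ∀ K t, |t| ≤ l₀ → ∀ s ∈ C K,
      ∀ᵐ U ∂((fieldMeasure P j (SUN N)).withDensity fun U => ENNReal.ofReal (Real.exp (t * Fobs U)) *
        ENNReal.ofReal (Real.exp (-(β * ∑ p ∈ Pall, (1 - reTr (GaugeField.plaqHol U p)))))),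
        |wilsonU (hPu s) U - uB K t s U| ≤ ρ 0 * θ 0) :
    LevelLedger l₀ (fun K => (C K).powerset)
      (fun K t => regionWeight (C K)
        ((fieldMeasure P j (SUN N)).withDensity fun U => ENNReal.ofReal (Real.exp (t * Fobs U)) *
          ENNReal.ofReal (Real.exp (-(β * ∑ p ∈ Pall, (1 - reTr (GaugeField.plaqHol U p))))))
        (fun s => wilsonU (hPu s)) (θ 0))
      (fun K t => regionShell (C K)
        ((fieldMeasure P j (SUN N)).withDensity fun U => ENNReal.ofReal (Real.exp (t * Fobs U)) *
          ENNReal.ofReal (Real.exp (-(β * ∑ p ∈ Pall, (1 - reTr (GaugeField.plaqHol U p))))))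
        (fun s => wilsonU (hPu s)) (uB K t) (θ 0))
      C
      (fun K t => regionPiece (C K)
        ((fieldMeasure P j (SUN N)).withDensity fun U => ENNReal.ofReal (Real.exp (t * Fobs U)) *
          ENNReal.ofReal (Real.exp (-(β * ∑ p ∈ Pall, (1 - reTr (GaugeField.plaqHol U p))))))
        (fun s => wilsonU (hPu s)) (uB K t) (θ 0))
      (fun _ _ => 0) D ρ := by
  -- every tilted Gibbs law is a finite measure (density ≤ e^{|t| w} against the product Haar probability)
  haveI : ∀ t : ℝ, IsFiniteMeasure ((fieldMeasure P j (SUN N)).withDensity fun U =>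
      ENNReal.ofReal (Real.exp (t * Fobs U)) *
        ENNReal.ofReal (Real.exp (-(β * ∑ p ∈ Pall, (1 - reTr (GaugeField.plaqHol U p)))))) := fun t => by
    refine isFiniteMeasure_withDensity (ne_top_of_le_ne_top ?_ (lintegral_mono (g := fun _ =>
      ENNReal.ofReal (Real.exp (|t| * w))) fun U => ?_))
    · rw [lintegral_const]; exact ENNReal.mul_ne_top ENNReal.ofReal_ne_top (measure_ne_top _ _)
    · calc ENNReal.ofReal (Real.exp (t * Fobs U)) *
            ENNReal.ofReal (Real.exp (-(β * ∑ p ∈ Pall, (1 - reTr (GaugeField.plaqHol U p)))))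
          ≤ ENNReal.ofReal (Real.exp (|t| * w)) * 1 := by
            refine mul_le_mul' (ENNReal.ofReal_le_ofReal (Real.exp_le_exp.2 ?_)) ?_
            · calc t * Fobs U ≤ |t * Fobs U| := le_abs_self _
                _ = |t| * |Fobs U| := abs_mul _ _
                _ ≤ |t| * w := mul_le_mul_of_nonneg_left (hFw U) (abs_nonneg t)
            · rw [ENNReal.ofReal_le_one, Real.exp_le_one_iff, neg_nonpos]
              exact mul_nonneg hβ (wilsonSum_nonneg Pall U)
        _ = ENNReal.ofReal (Real.exp (|t| * w)) := mul_one _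
  -- (M1)₀ per slot for `|t| ≤ l₀`, raised to the uniform constant `D 0`
  have hac : ∀ (K : ℕ) (t : ℝ), |t| ≤ l₀ → ∀ s ∈ C K, SlotAntiConcentration
      ((fieldMeasure P j (SUN N)).withDensity fun U => ENNReal.ofReal (Real.exp (t * Fobs U)) *
        ENNReal.ofReal (Real.exp (-(β * ∑ p ∈ Pall, (1 - reTr (GaugeField.plaqHol U p))))))
      (wilsonU (hPu s)) (θ 0) (ρ 0) (D 0) := fun K t ht s _ =>
    T4ShellMeasureFibre.slotAntiConcentration_mono (hρ0 0) (hD s)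
      (slotAntiConcentration_wilson_suN_gibbs_source (hN s) (hm s) (Λ s) (hΛbox s) (hΛcomb s) (hcov s) hS hS4 hσ
        (hN4 s) (hrad s) (hPu s) (hPubox s) (hboxPu s) (Pw s) (Pext s) Pall hβ hθ hθσ hδ0 hδ1 (hρ0 0) hρ hRad hSM
        hSMσ (hPext s) (hdisj s) (hall s) hw hFw ht)
  exact levelLedger_levelZero_cubes
    (μ := fun _ t => (fieldMeasure P j (SUN N)).withDensity fun U => ENNReal.ofReal (Real.exp (t * Fobs U)) *
      ENNReal.ofReal (Real.exp (-(β * ∑ p ∈ Pall, (1 - reTr (GaugeField.plaqHol U p))))))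
    (uA := fun _ _ s => wilsonU (hPu s)) (fun _ _ s => measurable_wilsonU (hPu s)) huB hclose hD0 hρ0 hac

end Ledger

/-! ## §3 The ledger over the cutoff-indexed lattice family (row S19 f3 at `G := SU(N)`) -/

section Family

variable (Pf : ℕ → Params) (jl : ℕ → ℕ) [∀ K, DecidableEq (PBond (Pf K) (jl K))] [∀ K, DecidableEq (Plaq (Pf K) (jl K))]
  {σ₀ : Type*} [DecidableEq σ₀]

/-- **THE LEVEL-0 ONE-RUN LEDGER OF THE `SU(N)` GIBBS MEASURES OVER THE CUTOFF-INDEXED LATTICE FAMILY.**  At cutoff `K`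
the run lives on the lattice `Pf K` (level `jl K`) with bare coupling `β K`, chart window `S K`, co-test threshold
`σc K`, radius `Rad K` and a bounded source `Fobs K`; every slot `s ∈ C K` carries leaf-10's box data on that lattice;
the realized measure of every slot at `(K, t)` is the tilted `SU(N)` Gibbs law of cutoff `K`.  HYPOTHESES displayed:
geometry/numerics per `K` (with `θ 0 ≤ σc K`), `|Fobs K| ≤ w`, the other run's measurable tested variables and the
per-cube a.e. closeness (node U1b at level 0), signs, and the UNIFORMITY ON THE LIVE SLOTS
`hD : ∀ K, ∀ s ∈ C K, 2(#Λ_{K,s}·d_N + β_K·#P_w·4S_K(8+16S_K))/(1−δ)·e^{2l₀w} ≤ D 0` (row S19 f3 v1.1's form: END-I uses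
(M1)₀ only for `s ∈ C K`, and level-0 cubes are live for finitely many cutoffs).  CONCLUSION: END-I's one-run
`LevelLedger` in its literal `K`-indexed shape, (M1)₀ discharged by §1.  NOT NE7c; nothing printed asserted. [folklore] -/
theorem levelLedger_wilson_suN_levelZero_family
    (lo hi : ∀ K, σ₀ → Fin (Pf K).d → ℤ) (m : ℕ → σ₀ → ℕ)
    (hN : ∀ K s κ, hi K s κ - lo K s κ < (Pf K).sitesPerDir (jl K)) (hm : ∀ K s κ, hi K s κ ≤ lo K s κ + m K s)
    (Λ : ∀ K, σ₀ → Finset (PBond (Pf K) (jl K))) (hΛbox : ∀ K s, ∀ b ∈ Λ K s, b ∈ boxBonds (lo K s) (hi K s))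
    (hΛcomb : ∀ K s, Disjoint (Λ K s) (combBonds (lo K s) (hi K s)))
    (hcov : ∀ K s, ∀ b ∈ boxBonds (lo K s) (hi K s), b ∉ Λ K s →
      b ∈ (combBonds (lo K s) (hi K s) : Finset (PBond (Pf K) (jl K))))
    (S σc Rad : ℕ → ℝ) (hS : ∀ K, 0 ≤ S K) (hS4 : ∀ K, S K ≤ 1 / 4) (hσ : ∀ K, 0 < σc K)
    (hN4 : ∀ K s, (N : ℝ) * ((((Pf K).d - 1 : ℕ) : ℝ) * m K s * σc K) < 4)
    (hrad : ∀ K s, Real.sqrt N * (Real.pi / 2 * ((((Pf K).d - 1 : ℕ) : ℝ) * m K s * σc K)) ≤ S K)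
    (Pu : ∀ K, σ₀ → Finset (Plaq (Pf K) (jl K))) (hPu : ∀ K s, (Pu K s).Nonempty)
    (hPubox : ∀ K s, ∀ p ∈ Pu K s, p ∈ boxPlaqs (lo K s) (hi K s))
    (hboxPu : ∀ K s, boxPlaqs (lo K s) (hi K s) ⊆ (↑(Pu K s) : Set (Plaq (Pf K) (jl K))))
    (Pw Pext : ∀ K, σ₀ → Finset (Plaq (Pf K) (jl K))) (Pall : ∀ K, Finset (Plaq (Pf K) (jl K)))
    (β : ℕ → ℝ) {δ : ℝ} {θ ρ D : ℕ → ℝ} (hβ : ∀ K, 0 ≤ β K) (hθ : 0 < θ 0) (hθσ : ∀ K, θ 0 ≤ σc K) (hδ0 : 0 ≤ δ)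
    (hδ1 : δ < 1) (hρ0 : ∀ i, 0 ≤ ρ i) (hρ : ρ 0 ≤ (1 - δ) / 2) (hRad : ∀ K, 1 < Rad K)
    (hSM : ∀ K, 36 * (Real.exp (4 * S K * Rad K) - 1) / (Rad K - 1) ^ 2 ≤ δ * θ 0)
    (hSMσ : ∀ K, 4 * (4 * S K) ^ 2 * Real.exp (2 * (4 * S K)) ≤ δ * σc K)
    (hPext : ∀ K s, ∀ p ∈ Pext K s, (⟨p.src, p.μ⟩ : PBond (Pf K) (jl K)) ∉ Λ K s ∧
      (⟨p.src.shift p.μ, p.ν⟩ : PBond (Pf K) (jl K)) ∉ Λ K s ∧ (⟨p.src.shift p.ν, p.μ⟩ : PBond (Pf K) (jl K)) ∉ Λ K s ∧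
      (⟨p.src, p.ν⟩ : PBond (Pf K) (jl K)) ∉ Λ K s)
    (hdisj : ∀ K s, Disjoint (Pext K s) (Pw K s)) (hall : ∀ K s, Pext K s ∪ Pw K s = Pall K)
    (Fobs : ∀ K, GaugeField (Pf K) (jl K) (SUN N) → ℝ) {w l₀ : ℝ} (hw : 0 ≤ w) (hFw : ∀ K U, |Fobs K U| ≤ w)
    (hD0 : ∀ i, 0 ≤ D i)
    (C : ℕ → Finset σ₀)
    (hD : ∀ K, ∀ s ∈ C K, 2 * ((((Λ K s).card * dimSU N : ℕ) : ℝ) +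
      β K * ∑ _p ∈ Pw K s, (4 * S K) * (8 + 4 * (4 * S K))) / (1 - δ) * Real.exp (2 * l₀ * w) ≤ D 0)
    (uB : ∀ K : ℕ, ℝ → σ₀ → GaugeField (Pf K) (jl K) (SUN N) → ℝ)
    (huB : ∀ K t s, Measurable (uB K t s))
    (hclose : ∀ K t, |t| ≤ l₀ → ∀ s ∈ C K,
      ∀ᵐ U ∂((fieldMeasure (Pf K) (jl K) (SUN N)).withDensity fun U => ENNReal.ofReal (Real.exp (t * Fobs K U)) *
        ENNReal.ofReal (Real.exp (-(β K * ∑ p ∈ Pall K, (1 - reTr (GaugeField.plaqHol U p)))))),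
        |wilsonU (hPu K s) U - uB K t s U| ≤ ρ 0 * θ 0) :
    LevelLedger l₀ (fun K => (C K).powerset)
      (fun K t => regionWeight (C K)
        ((fieldMeasure (Pf K) (jl K) (SUN N)).withDensity fun U => ENNReal.ofReal (Real.exp (t * Fobs K U)) *
          ENNReal.ofReal (Real.exp (-(β K * ∑ p ∈ Pall K, (1 - reTr (GaugeField.plaqHol U p))))))
        (fun s => wilsonU (hPu K s)) (θ 0))
      (fun K t => regionShell (C K)
        ((fieldMeasure (Pf K) (jl K) (SUN N)).withDensity fun U => ENNReal.ofReal (Real.exp (t * Fobs K U)) *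
          ENNReal.ofReal (Real.exp (-(β K * ∑ p ∈ Pall K, (1 - reTr (GaugeField.plaqHol U p))))))
        (fun s => wilsonU (hPu K s)) (uB K t) (θ 0))
      C
      (fun K t => regionPiece (C K)
        ((fieldMeasure (Pf K) (jl K) (SUN N)).withDensity fun U => ENNReal.ofReal (Real.exp (t * Fobs K U)) *
          ENNReal.ofReal (Real.exp (-(β K * ∑ p ∈ Pall K, (1 - reTr (GaugeField.plaqHol U p))))))
        (fun s => wilsonU (hPu K s)) (uB K t) (θ 0))
      (fun _ _ => 0) D ρ := by
  -- every tilted Gibbs law is a finite measure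
  haveI : ∀ (K : ℕ) (t : ℝ), IsFiniteMeasure ((fieldMeasure (Pf K) (jl K) (SUN N)).withDensity fun U =>
      ENNReal.ofReal (Real.exp (t * Fobs K U)) *
        ENNReal.ofReal (Real.exp (-(β K * ∑ p ∈ Pall K, (1 - reTr (GaugeField.plaqHol U p)))))) := fun K t => by
    refine isFiniteMeasure_withDensity (ne_top_of_le_ne_top ?_ (lintegral_mono (g := fun _ =>
      ENNReal.ofReal (Real.exp (|t| * w))) fun U => ?_))
    · rw [lintegral_const]; exact ENNReal.mul_ne_top ENNReal.ofReal_ne_top (measure_ne_top _ _)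
    · calc ENNReal.ofReal (Real.exp (t * Fobs K U)) *
            ENNReal.ofReal (Real.exp (-(β K * ∑ p ∈ Pall K, (1 - reTr (GaugeField.plaqHol U p)))))
          ≤ ENNReal.ofReal (Real.exp (|t| * w)) * 1 := by
            refine mul_le_mul' (ENNReal.ofReal_le_ofReal (Real.exp_le_exp.2 ?_)) ?_
            · calc t * Fobs K U ≤ |t * Fobs K U| := le_abs_self _
                _ = |t| * |Fobs K U| := abs_mul _ _
                _ ≤ |t| * w := mul_le_mul_of_nonneg_left (hFw K U) (abs_nonneg t)
            · rw [ENNReal.ofReal_le_one, Real.exp_le_one_iff, neg_nonpos]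
              exact mul_nonneg (hβ K) (wilsonSum_nonneg (Pall K) U)
        _ = ENNReal.ofReal (Real.exp (|t| * w)) := mul_one _
  -- (M1)₀ per (K, live slot) for `|t| ≤ l₀`, raised to the uniform constant `D 0`
  have hac : ∀ (K : ℕ) (t : ℝ), |t| ≤ l₀ → ∀ s ∈ C K, SlotAntiConcentration
      ((fieldMeasure (Pf K) (jl K) (SUN N)).withDensity fun U => ENNReal.ofReal (Real.exp (t * Fobs K U)) *
        ENNReal.ofReal (Real.exp (-(β K * ∑ p ∈ Pall K, (1 - reTr (GaugeField.plaqHol U p))))))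
      (wilsonU (hPu K s)) (θ 0) (ρ 0) (D 0) := fun K t ht s hs =>
    T4ShellMeasureFibre.slotAntiConcentration_mono (hρ0 0) (hD K s hs)
      (slotAntiConcentration_wilson_suN_gibbs_source (hN K s) (hm K s) (Λ K s) (hΛbox K s) (hΛcomb K s) (hcov K s)
        (hS K) (hS4 K) (hσ K) (hN4 K s) (hrad K s) (hPu K s) (hPubox K s) (hboxPu K s) (Pw K s) (Pext K s) (Pall K)
        (hβ K) hθ (hθσ K) hδ0 hδ1 (hρ0 0) hρ (hRad K) (hSM K) (hSMσ K) (hPext K s) (hdisj K s) (hall K s) hw (hFw K)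
        ht)
  exact levelLedger_levelZero_cubes
    (μ := fun K t => (fieldMeasure (Pf K) (jl K) (SUN N)).withDensity fun U =>
      ENNReal.ofReal (Real.exp (t * Fobs K U)) *
        ENNReal.ofReal (Real.exp (-(β K * ∑ p ∈ Pall K, (1 - reTr (GaugeField.plaqHol U p))))))
    (uA := fun K _ s => wilsonU (hPu K s)) (fun K _ s => measurable_wilsonU (hPu K s)) huB hclose hD0 hρ0 hac

end Family

end Summit.QuantumFields.BalabanUV.T4Continuum.ShellMeasureWilsonLedgerSUNSource

end
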